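import Summits.NavierStokesRegularity.NavierStokesRegularity.Theorems.TypeILiouvilleShadowExtractionEngine
import Summits.NavierStokesRegularity.NavierStokesRegularity.Theorems.TypeILiouvilleQuiescentShadow
import HarnessLib


/-!
# decomp-ns lens 2, g20 — SX «SHADOW EXTRACTION» PROVED: the α-limit cut of (L) is exact (part 2/2)

Kernel proof (0 sorry) of the registered first target `stub_shadowExtraction` of the LINE
`Cruxes/TypeIliouvilleL/Lines/quiescent-shadow.lean` on the KNSS Liouville crux `TypeIliouvilleL`
(stmt-NavierStokesRegularity-10661): a member of print's class of bounded ancient mild solutions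
(continuous, bounded, weakly divergence-free, Oseen-mild on `(−∞,0) × ℝ³`) whose past is NOT
quiescent has an ETERNAL SHADOW — a bounded smooth mild solution on `ℝ × ℝ³`, ancient-mild after every
time shift, with a non-constant time slice. With the landed node theorem
`Theorems.TypeILiouvilleQuiescentShadow.liouvilleL_iff_eternal_and_quiescent` this makes the g16 cut
EXACT: `(L) ⟺ EternalLiouville ∧ QuiescentLiouville`.

* §A/§B (part 1, `TypeILiouvilleShadowExtractionEngine.lean`): the box exhaustion of `ℝ × E` and
  the ETERNAL extraction engine `exists_oseenMild_eternal_limit` (KNSS 2009 Lemma 6.1 with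
  two-sided windows `(A_k, B_k)`, `A_k → −∞`, `B_k → +∞`): the tree's one-sided engine
  `exists_oseenMild_limit_of_monotone_bound` verbatim up to the windows;
* §C `shadowExtraction_holds` = the stub signature verbatim, and the exact cut by name.

Tree-ready: written to land verbatim as `Summits/NavierStokesRegularity/NavierStokesRegularity/Theorems/
TypeILiouvilleShadowExtraction.lean` with `--supports stmt-NavierStokesRegularity-10661` (closes the registered
stub `stub_shadowExtraction`; axiom closure of every theorem here = {propext, Classical.choice, Quot.sound}).

Sources: KNSS 2009 (arXiv:0709.3599) Lemma 6.1, proof of Thm 6.2 [KochNadirashviliSereginSverak2009];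
Seregin 2014 lecture notes §6.4; Poláčik–Quittner–Souplet 2007 (the doubling/translation-compactness move);
lens files HOME/decomp-ns-lens-2/QuiescentShadow.lean (g16 node), NODE-g20.md.
-/


set_option linter.dupNamespace false

noncomputable section

open MeasureTheory Filter Set Function Metric TopologicalSpace
open scoped Topology RealInnerProductSpace NNReal ENNReal
open Literature.Analysis Literature.Analysis.FluidPDE Literature.Analysis.UnboundedOperators
open Summit.NavierStokesRegularity.NavierStokesRegularity

namespace Summit.NavierStokesRegularity.NavierStokesRegularity.Theorems.TypeILiouvilleShadowExtraction

/-! ## §C SX «SHADOW EXTRACTION» for print's class, and the exact cut `(L) ⟺ EL ∧ L_Q` -/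

section SX

/-- **Print's class under an arbitrary space-time translation** (S1 with the natural window): for
ANY `t₀ : ℝ` and `x₀`, the translate `w(t,x) := v(t + t₀, x + x₀)` of a member `v` of print's class
(continuous, bounded by `K`, weakly divergence-free, Oseen-mild on `(−∞,0) × ℝ³`) is continuous and
bounded by `K` on `(−∞, −t₀) × ℝ³`, weakly divergence-free there, and satisfies the Oseen identity for
all `s < t < −t₀` (tree: `heatExtension_comp_add_right_apply`, `oseenDuhamel_comp_add_right`,
`oseenDuhamel_translate`, `IsWeaklyDivFree.comp_add_right'`). -/
theorem printClass_translate_window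
    {v : ℝ → EuclideanSpace ℝ (Fin 3) → EuclideanSpace ℝ (Fin 3)} {K : ℝ}
    (hc : ContinuousOn (uncurry v) (Iio 0 ×ˢ univ))
    (hK : ∀ t < 0, ∀ x, ‖v t x‖ ≤ K)
    (hd : ∀ t < 0, IsWeaklyDivFree (v t))
    (hm : ∀ s t : ℝ, s < t → t < 0 → ∀ x,
      v t x = UnboundedOperators.heatExtension (v s) (t - s) x - oseenDuhamel 1 s v v t x)
    (t₀ : ℝ) (x₀ : EuclideanSpace ℝ (Fin 3)) :
    ContinuousOn (uncurry (fun t x => v (t + t₀) (x + x₀))) (Iio (-t₀) ×ˢ univ) ∧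
    (∀ t < -t₀, ∀ x, ‖(fun t x => v (t + t₀) (x + x₀)) t x‖ ≤ K) ∧
    (∀ t < -t₀, IsWeaklyDivFree ((fun t x => v (t + t₀) (x + x₀)) t)) ∧
    (∀ s t : ℝ, s < t → t < -t₀ → ∀ x,
      (fun t x => v (t + t₀) (x + x₀)) t x =
        UnboundedOperators.heatExtension ((fun t x => v (t + t₀) (x + x₀)) s) (t - s) x -
        oseenDuhamel 1 s (fun t x => v (t + t₀) (x + x₀)) (fun t x => v (t + t₀) (x + x₀)) t x) := by
  refine ⟨?_, ?_, ?_, ?_⟩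
  · have hφ : Continuous (fun p : ℝ × EuclideanSpace ℝ (Fin 3) => (p.1 + t₀, p.2 + x₀)) := by
      fun_prop
    have hmaps : MapsTo (fun p : ℝ × EuclideanSpace ℝ (Fin 3) => (p.1 + t₀, p.2 + x₀))
        (Iio (-t₀) ×ˢ univ) (Iio 0 ×ˢ univ) := by
      intro p hp
      simp only [mem_prod, mem_Iio, mem_univ, and_true] at hp ⊢
      linarith
    exact (hc.comp hφ.continuousOn hmaps).congr (fun p _ => rfl)
  · intro t ht x
    exact hK (t + t₀) (by linarith) (x + x₀)
  · intro t ht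
    exact (hd (t + t₀) (by linarith)).comp_add_right' x₀
  · intro s t hst ht0 x
    have h1 : oseenDuhamel 1 s (fun t x => v (t + t₀) (x + x₀)) (fun t x => v (t + t₀) (x + x₀)) t x =
        oseenDuhamel 1 s (fun τ => v (τ + t₀)) (fun τ => v (τ + t₀)) t (x + x₀) :=
      oseenDuhamel_comp_add_right 1 s (fun τ => v (τ + t₀)) (fun τ => v (τ + t₀)) x₀ t x
    have h2 : oseenDuhamel 1 s (fun τ => v (τ + t₀)) (fun τ => v (τ + t₀)) t (x + x₀) =
        oseenDuhamel 1 (s + t₀) v v (t + t₀) (x + x₀) :=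
      oseenDuhamel_translate 1 s t₀ v v t (x + x₀)
    have h3 : UnboundedOperators.heatExtension ((fun t x => v (t + t₀) (x + x₀)) s) (t - s) x =
        UnboundedOperators.heatExtension (v (s + t₀)) (t - s) (x + x₀) :=
      heatExtension_comp_add_right_apply (v (s + t₀)) x₀ (t - s) x
    have h4 := hm (s + t₀) (t + t₀) (by linarith) (by linarith) (x + x₀)
    have h5 : t + t₀ - (s + t₀) = t - s := by ring
    rw [h5] at h4
    show v (t + t₀) (x + x₀) = _
    rw [h3, h1, h2]
    exact h4

/-- **An eternal bounded Oseen-mild field is ancient-mild after every time shift, bounded,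
measurable slice-wise and smooth** (S4, the class conversion): tree
`isBoundedAncientMildSolution_of_oseen`, `oseenDuhamel_translate`, `contDiffOn_of_bounded_oseenMild`. -/
theorem eternal_package {W : ℝ → EuclideanSpace ℝ (Fin 3) → EuclideanSpace ℝ (Fin 3)} {C : ℝ}
    (hWc : Continuous (uncurry W)) (hWd : ∀ t, IsWeaklyDivFree (W t)) (hWb : ∀ t x, ‖W t x‖ ≤ C)
    (hWm : ∀ s t : ℝ, s < t → ∀ x,
      W t x = UnboundedOperators.heatExtension (W s) (t - s) x - oseenDuhamel 1 s W W t x) :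
    (∀ τ : ℝ, IsAncientMildSolution 1 (fun t => W (t + τ))) ∧
    (∃ C : ℝ, ∀ t x, ‖W t x‖ ≤ C) ∧
    (∀ t, AEStronglyMeasurable (W t) volume) ∧
    ContDiff ℝ (⊤ : ℕ∞) (uncurry W) := by
  have hWslice : ∀ t, Continuous (W t) := fun t => hWc.comp (Continuous.prodMk_right t)
  -- the time shifts `W(· + c)` are eternal bounded Oseen-mild fields too
  have hshift_cont : ∀ c : ℝ, Continuous (uncurry fun t => W (t + c)) := fun c =>
    hWc.comp (show Continuous (fun p : ℝ × EuclideanSpace ℝ (Fin 3) => (p.1 + c, p.2)) by fun_prop)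
  have hshift_mild : ∀ c : ℝ, ∀ s t : ℝ, s < t → ∀ x,
      (fun t => W (t + c)) t x =
        UnboundedOperators.heatExtension ((fun t => W (t + c)) s) (t - s) x -
          oseenDuhamel 1 s (fun t => W (t + c)) (fun t => W (t + c)) t x := by
    intro c s t hst x
    show W (t + c) x = UnboundedOperators.heatExtension (W (s + c)) (t - s) x -
      oseenDuhamel 1 s (fun τ => W (τ + c)) (fun τ => W (τ + c)) t x
    rw [oseenDuhamel_translate 1 s c W W t x, show t - s = t + c - (s + c) by ring]
    exact hWm (s + c) (t + c) (by linarith) x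
  refine ⟨fun τ => ?_, ⟨C, hWb⟩, fun t => (hWslice t).aestronglyMeasurable, ?_⟩
  · -- ancient mild after the shift, via the tree's conversion for print's class
    refine (isBoundedAncientMildSolution_of_oseen one_pos (hshift_cont τ).continuousOn
      ⟨C, fun t _ x => hWb (t + τ) x⟩ (fun t _ => hWd (t + τ)) fun s t hst _ x => ?_).1
    rw [one_mul]
    exact hshift_mild τ s t hst x
  · -- smoothness: locally, `W` is a backward shift of a bounded Oseen-mild field on `(−2, 0) × ℝ³`
    rw [contDiff_iff_contDiffAt]
    rintro ⟨t, x⟩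
    set c : ℝ := t + 1 with hc
    have hwin : ContDiffOn ℝ (⊤ : ℕ∞) (uncurry fun s => W (s + c)) (Ioo (-2 : ℝ) 0 ×ˢ univ) :=
      contDiffOn_of_bounded_oseenMild (A := -2) (M := C) (u := fun s => W (s + c))
        (hshift_cont c).continuousOn (fun s _ => hWd (s + c))
        (fun s s' h1 h2 _ y => hshift_mild c s s' h2 y) (fun s _ y => hWb (s + c) y)
    have hsh : ContDiff ℝ (⊤ : ℕ∞) (fun p : ℝ × EuclideanSpace ℝ (Fin 3) => (p.1 - c, p.2)) := by
      fun_prop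
    have hmem : ((fun p : ℝ × EuclideanSpace ℝ (Fin 3) => (p.1 - c, p.2)) (t, x)) ∈
        Ioo (-2 : ℝ) 0 ×ˢ (univ : Set (EuclideanSpace ℝ (Fin 3))) := by
      refine ⟨⟨?_, ?_⟩, mem_univ _⟩
      · show (-2 : ℝ) < t - c
        rw [hc]; linarith
      · show t - c < 0
        rw [hc]; linarith
    have hat : ContDiffAt ℝ (⊤ : ℕ∞) (uncurry fun s => W (s + c))
        ((fun p : ℝ × EuclideanSpace ℝ (Fin 3) => (p.1 - c, p.2)) (t, x)) :=
      hwin.contDiffAt ((isOpen_Ioo.prod isOpen_univ).mem_nhds hmem)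
    have hcomp := hat.comp (t, x) hsh.contDiffAt
    refine hcomp.congr_of_eventuallyEq (Eventually.of_forall fun p => ?_)
    show W p.1 p.2 = W (p.1 - c + c) p.2
    rw [sub_add_cancel]

/-- **SX — SHADOW EXTRACTION, PROVED** (the registered first target `stub_shadowExtraction` of the
line `Cruxes/TypeIliouvilleL/Lines/quiescent-shadow.lean`, signature verbatim; = the g16 support
`ShadowExtraction`): a member of print's class whose past is NOT quiescent has an eternal shadow — a
bounded smooth field on `ℝ × ℝ³`, ancient-mild after every time shift, with a non-constant slice.
Proof (KNSS 2009 Lemma 6.1 / Poláčik–Quittner–Souplet doubling move): non-quiescence gives `ε > 0`,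
times `t_k → −∞` and pairs `|x_k − y_k| ≤ 1` with `‖v(t_k,x_k) − v(t_k,y_k)‖ > ε`; pass to a
subsequence with `y_k − x_k → d`; the translates `v(· + t_k, · + x_k)` live on the windows
`(−∞, −t_k)`, `−t_k → +∞` (`printClass_translate_window`); the eternal engine
`exists_oseenMild_eternal_limit` extracts a limit `W`, eternal bounded Oseen-mild, with
`v(t_k, x_k) → W(0,0)` and (slice-wise locally uniform convergence) `v(t_k, y_k) → W(0,d)`, whence
`‖W(0,0) − W(0,d)‖ ≥ ε`; `eternal_package` converts the class. -/
theorem shadowExtraction_holds :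
    ∀ v : ℝ → EuclideanSpace ℝ (Fin 3) → EuclideanSpace ℝ (Fin 3),
      ContinuousOn (Function.uncurry v) (Set.Iio 0 ×ˢ Set.univ) →
      (∃ K : ℝ, ∀ t < 0, ∀ x, ‖v t x‖ ≤ K) →
      (∀ t < 0, Literature.Analysis.FluidPDE.IsWeaklyDivFree (v t)) →
      (∀ s t : ℝ, s < t → t < 0 → ∀ x,
        v t x = Literature.Analysis.UnboundedOperators.heatExtension (v s) (t - s) x -
          Literature.Analysis.FluidPDE.oseenDuhamel 1 s v v t x) →
      ¬ (∀ ε : ℝ, 0 < ε → ∃ T : ℝ, T < 0 ∧ ∀ t < T, ∀ x y : EuclideanSpace ℝ (Fin 3),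
          dist x y ≤ 1 → ‖v t x - v t y‖ ≤ ε) →
      ∃ V : ℝ → EuclideanSpace ℝ (Fin 3) → EuclideanSpace ℝ (Fin 3),
        (∀ τ : ℝ, Literature.Analysis.FluidPDE.IsAncientMildSolution 1 (fun t => V (t + τ))) ∧
        (∃ C : ℝ, ∀ t x, ‖V t x‖ ≤ C) ∧
        (∀ t, MeasureTheory.AEStronglyMeasurable (V t) MeasureTheory.volume) ∧
        ContDiff ℝ (⊤ : ℕ∞) (Function.uncurry V) ∧
        ∃ (t : ℝ) (x y : EuclideanSpace ℝ (Fin 3)), V t x ≠ V t y := by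
  intro v hc hK hd hm hnq
  obtain ⟨K, hK⟩ := hK
  -- ## non-quiescence: an `ε`-oscillation at unit scale along times `t_k < -(k+2)`
  push Not at hnq
  obtain ⟨ε, hε, hT⟩ := hnq
  have hsel : ∀ k : ℕ, ∃ t : ℝ, t < -((k : ℝ) + 2) ∧ ∃ x y : EuclideanSpace ℝ (Fin 3),
      dist x y ≤ 1 ∧ ε < ‖v t x - v t y‖ := fun k =>
    hT (-((k : ℝ) + 2)) (by have : (0 : ℝ) ≤ k := Nat.cast_nonneg k; linarith)
  choose tk htk xk yk hdist hosc using hsel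
  -- ## the displacements `d_k := y_k − x_k` lie in the unit ball: pass to a convergent subsequence
  have hdk : ∀ k, yk k - xk k ∈ closedBall (0 : EuclideanSpace ℝ (Fin 3)) 1 := fun k => by
    rw [mem_closedBall, dist_zero_right, ← dist_eq_norm, dist_comm]
    exact hdist k
  obtain ⟨d, -, ψ, hψ, hdlim⟩ := (isCompact_closedBall (0 : EuclideanSpace ℝ (Fin 3)) 1).tendsto_subseq hdk
  -- ## the translates `v(· + t_{ψ k}, · + x_{ψ k})` on the windows `(−(k+1), −t_{ψ k})`
  have H := fun k => printClass_translate_window hc hK hd hm (tk (ψ k)) (xk (ψ k))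
  have hAlim : Tendsto (fun k : ℕ => -((k : ℝ) + 1)) atTop atBot :=
    tendsto_neg_atTop_atBot.comp (tendsto_atTop_add_const_right atTop 1 tendsto_natCast_atTop_atTop)
  have hBge : ∀ k : ℕ, (k : ℝ) + 2 < -tk (ψ k) := fun k => by
    have h1 := htk (ψ k)
    have h2 : (k : ℝ) ≤ (ψ k : ℝ) := Nat.cast_le.2 (hψ.id_le k)
    linarith
  have hBlim : Tendsto (fun k : ℕ => -tk (ψ k)) atTop atTop :=
    tendsto_atTop_mono (fun k => by linarith [hBge k]) tendsto_natCast_atTop_atTop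
  obtain ⟨φ, W, hφ, hWc, hWd, hWb, hWm, -, hpt, hloc⟩ :=
    exists_oseenMild_eternal_limit (A := fun k : ℕ => -((k : ℝ) + 1)) (B := fun k => -tk (ψ k))
      (w := fun k t x => v (t + tk (ψ k)) (x + xk (ψ k))) (C := K) hAlim hBlim
      (fun k => (H k).1.mono (prod_mono Ioo_subset_Iio_self Subset.rfl))
      (fun k t ht => (H k).2.2.1 t ht.2)
      (fun k s t _ hst htB x => (H k).2.2.2 s t hst htB x)
      (fun k τ hτ x => (H k).2.1 τ hτ.2 x)
  have hφt : Tendsto φ atTop atTop := hφ.tendsto_atTop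
  have hWslice : ∀ t, Continuous (W t) := fun t => hWc.comp (Continuous.prodMk_right t)
  -- ## the two limits at time `0`: `v(t_k, x_k) → W(0,0)` and `v(t_k, y_k) → W(0,d)`
  have h00 : Tendsto (fun j => v (tk (ψ (φ j))) (xk (ψ (φ j)))) atTop (𝓝 (W 0 0)) := by
    have h := hpt 0 0
    simp only [zero_add] at h
    exact h
  have hdφ : Tendsto (fun j => yk (ψ (φ j)) - xk (ψ (φ j))) atTop (𝓝 d) := hdlim.comp hφt
  have h0d : Tendsto (fun j => v (tk (ψ (φ j))) (yk (ψ (φ j)))) atTop (𝓝 (W 0 d)) := by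
    have h := (hloc 0).tendsto_comp (hWslice 0).continuousAt hdφ
    simp only [zero_add, sub_add_cancel] at h
    exact h
  have hεle : ε ≤ ‖W 0 0 - W 0 d‖ :=
    ge_of_tendsto' ((h00.sub h0d).norm) fun j => (hosc (ψ (φ j))).le
  -- ## the package
  obtain ⟨hanc, hbd, hmeas, hsmooth⟩ := eternal_package hWc hWd hWb hWm
  refine ⟨W, hanc, hbd, hmeas, hsmooth, 0, 0, d, fun heq => ?_⟩
  rw [heq, sub_self, norm_zero] at hεle
  exact absurd hεle (not_le.2 hε)

/-- The REGISTERED STUB `stub_shadowExtraction` of the line `Cruxes/TypeIliouvilleL/Lines/quiescent-shadow.lean`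
(crux `TypeIliouvilleL`, stmt-NavierStokesRegularity-10661), by name with its verbatim registered signature:
it is `shadowExtraction_holds`. [cite: KochNadirashviliSereginSverak2009, Lemma 6.1 (arXiv:0709.3599)] -/
theorem stub_shadowExtraction :
    ∀ v : ℝ → EuclideanSpace ℝ (Fin 3) → EuclideanSpace ℝ (Fin 3), ContinuousOn (Function.uncurry v) (Set.Iio 0 ×ˢ Set.univ) → (∃ K : ℝ, ∀ t < 0, ∀ x, ‖v t x‖ ≤ K) → (∀ t < 0, Literature.Analysis.FluidPDE.IsWeaklyDivFree (v t)) → (∀ s t : ℝ, s < t → t < 0 → ∀ x, v t x = Literature.Analysis.UnboundedOperators.heatExtension (v s) (t - s) x - Literature.Analysis.FluidPDE.oseenDuhamel 1 s v v t x) → ¬ (∀ ε : ℝ, 0 < ε → ∃ T : ℝ, T < 0 ∧ ∀ t < T, ∀ x y : EuclideanSpace ℝ (Fin 3), dist x y ≤ 1 → ‖v t x - v t y‖ ≤ ε) → ∃ V : ℝ → EuclideanSpace ℝ (Fin 3) → EuclideanSpace ℝ (Fin 3), (∀ τ : ℝ, Literature.Analysis.FluidPDE.IsAncientMildSolution 1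 (fun t => V (t + τ))) ∧ (∃ C : ℝ, ∀ t x, ‖V t x‖ ≤ C) ∧ (∀ t, MeasureTheory.AEStronglyMeasurable (V t) MeasureTheory.volume) ∧ ContDiff ℝ (⊤ : ℕ∞) (Function.uncurry V) ∧ ∃ (t : ℝ) (x y : EuclideanSpace ℝ (Fin 3)), V t x ≠ V t y :=
  shadowExtraction_holds

/-- SX by name: the g16 cut is EXACT — `(L) ⟺ EternalLiouville ∧ QuiescentLiouville` (tree node
theorem `Theorems.TypeILiouvilleQuiescentShadow.liouvilleL_iff_eternal_and_quiescent` fed with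
`shadowExtraction_holds`; `L_Q` spelled inline exactly as there). -/
theorem liouvilleL_iff_eternal_and_quiescent_exact :
    Theses.TypeILiouville.TypeIliouvilleL ↔
      (Theses.TypeTwoEternal.EternalLiouville ∧
        ∀ v : ℝ → EuclideanSpace ℝ (Fin 3) → EuclideanSpace ℝ (Fin 3),
          ContinuousOn (Function.uncurry v) (Set.Iio 0 ×ˢ Set.univ) →
          (∃ K : ℝ, ∀ t < 0, ∀ x, ‖v t x‖ ≤ K) →
          (∀ t < 0, Literature.Analysis.FluidPDE.IsWeaklyDivFree (v t)) →
          (∀ s t : ℝ, s < t → t < 0 → ∀ x,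
            v t x = Literature.Analysis.UnboundedOperators.heatExtension (v s) (t - s) x -
              Literature.Analysis.FluidPDE.oseenDuhamel 1 s v v t x) →
          (∀ ε : ℝ, 0 < ε → ∃ T : ℝ, T < 0 ∧ ∀ t < T, ∀ x y : EuclideanSpace ℝ (Fin 3),
              dist x y ≤ 1 → ‖v t x - v t y‖ ≤ ε) →
          ∃ b : EuclideanSpace ℝ (Fin 3), ∀ t < 0, ∀ x, v t x = b) :=
  Theorems.TypeILiouvilleQuiescentShadow.liouvilleL_iff_eternal_and_quiescent shadowExtraction_holds

end SX

end Summit.NavierStokesRegularity.NavierStokesRegularity.Theorems.TypeILiouvilleShadowExtraction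

end
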